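import Summits.HodgeConjecture.HodgeConjecture.Theses.BoundaryReadout
import Literature.AlgebraicGeometry.HodgeTheory.HodgeTypeExteriorProduct

/-!
# Negation lens for `BoundaryAbsoluteness` (stmt-HodgeConjecture-15913): the crux is HC-safe

Strategy-census evidence (crux-strategist, 2026-08-17). Granting the printed theorem "cycle classes
are absolute Hodge" (Charles–Schnell §11.2.2, after Def. 11.2.3; Deligne 1982 Ex. 2.1(a)) as the
explicit hypothesis `hAH` (not in the tree), a refutation of the crux is a refutation of the Hodge
conjecture: the conclusion of the crux concerns the rational `(p,p)` class `ξ|X_t` on the smooth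
projective fibre `X_t`, which HC makes algebraic, hence absolute Hodge — whatever the hypotheses on
the covered fibre. So no counterexample exists short of a non-absolute Hodge class (`¬` Conj. 11.2.17,
hence `¬HC`); the hypotheses of the crux (absoluteness on the pieces `Y_i`) are not even used.
-/

noncomputable section

namespace Summit.HodgeConjecture.HodgeConjecture.Cruxes.BoundaryAbsoluteness.NegationCensus

open CategoryTheory AlgebraicGeometry
open Literature.AlgebraicGeometry.Motives Literature.AlgebraicGeometry.HodgeTheory
open Summit.HodgeConjecture.HodgeConjecture.Theses.BoundaryReadout (BoundaryAbsoluteness)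

/-- **HC + (cycle classes absolute Hodge) ⟹ the crux**, without using its boundary hypotheses.
[cite: CharlesSchnell2014Notes, §11.2.2 and Conj. 11.2.17] -/
theorem boundaryAbsoluteness_of_hodgeConjecture
    (hAH : ∀ ⦃n : ℕ⦄ ⦃X : SchemeOver ℂ⦄, IsSmoothProjective n X →
      ∀ (p : ℕ) (c : complexBetti X (2 * p)), IsRationalClass c → IsOfHodgeType n X (2 * p) p p c →
        c ∈ algebraicClasses X p → IsAbsoluteHodgeClass n X p c)
    (hHC : _root_.HodgeConjecture) : BoundaryAbsoluteness := by
  intro N p 𝒳 C f o h𝒳 hC hf ι _ m Y g hY hcov ξ hξr hξh habs t n ht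
  have hr : IsRationalClass (complexBetti.map (fiberι f t) (2 * p) ξ) := hξr.pullback _
  have hpp : IsOfHodgeType n (fiberOver f t) (2 * p) p p (complexBetti.map (fiberι f t) (2 * p) ξ) :=
    hξh.map_of_isSmoothProjective ht h𝒳 (fiberι f t)
  exact hAH ht p _ hr hpp ((hHC ht).2 p _ hr hpp)

/-- **The crux is HC-safe**: granting cycle classes absolute Hodge, `¬ BoundaryAbsoluteness → ¬ HC`.
A counterexample to the crux is a rational `(p,p)` class on a smooth projective variety that is not
absolute Hodge, i.e. a counterexample to Charles–Schnell Conj. 11.2.17 and to the Hodge conjecture.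
[cite: CharlesSchnell2014Notes, §11.2.5 Conj. 11.2.17] -/
theorem not_hodgeConjecture_of_not_boundaryAbsoluteness
    (hAH : ∀ ⦃n : ℕ⦄ ⦃X : SchemeOver ℂ⦄, IsSmoothProjective n X →
      ∀ (p : ℕ) (c : complexBetti X (2 * p)), IsRationalClass c → IsOfHodgeType n X (2 * p) p p c →
        c ∈ algebraicClasses X p → IsAbsoluteHodgeClass n X p c)
    (h : ¬ BoundaryAbsoluteness) : ¬ _root_.HodgeConjecture :=
  fun hHC ↦ h (boundaryAbsoluteness_of_hodgeConjecture hAH hHC)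

end Summit.HodgeConjecture.HodgeConjecture.Cruxes.BoundaryAbsoluteness.NegationCensus

end
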